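import Summits.CriticalPhenomena.PercolationContinuityZ3.Theorems.SoloBlindSparseFins
import Mathlib.Analysis.SpecificLimits.Basic

/-!
# The square fin, and fins with fast-growing gaps: explicit regions strictly above `ℍ` with
# `θ(p_c(ℤ³)) = 0`

Seat `solo-CriticalPhenomena-blind`.  From the fin-side criterion of `SoloBlindSparseFins` and the
exponential decay of in-plane connections at `p_c(ℤ³) < 1/2` (`RegionGluing.exists_exp_decay_finFeet`,
i.e. `DCT16.perc_sharpness_holds` + `kesten_criticalProb_Z3_lt_half_holds` + `kesten_criticalProb_Z2_holds`):

* `theta_induce_sparseFin_criticalProbI_eq_zero_of_expSummable` — any height set `Z` with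
  `Σ_{z ≠ z' ∈ Z} exp(-c (|z - z'| - 1)) < ∞` for every `c > 0` works;
* `theta_induce_squareFin_criticalProbI_eq_zero` — **THE SQUARE FIN**
  `ℍ ∪ {x₁ = 0, x₀ ≤ -2} ∪ {(-1, 0, j²) : j ∈ ℕ}` has `θ(p_c(ℤ³)) = 0` at every root, unconditionally:
  an explicit region strictly between `ℍ` and `ℤ³`, contained in no half-space
  (`tsum_sqPairs_exp_ne_top`: `|i² - j²| ≥ i + j`); `theta_induce_squareFin_own_criticalProb_eq_zero`:
  modulo `GrimmettMarstrand1990_halfSpace` its critical point is `p_c(ℤ³)`;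
* `theta_induce_sparseFin_criticalProbI_eq_zero_of_gaps` — more generally any strictly increasing
  heights `f : ℕ → ℤ` with `Σ_k exp(-c (f (k+1) - f k)) < ∞` for every `c > 0`
  (`tsum_rangePairs_exp_ne_top`: reindex pairs by orientation, smaller index and index gap).
Bounded gaps remain open (the fin rung).
-/

noncomputable section

namespace Summit.CriticalPhenomena.PercolationContinuityZ3.Theorems

open MeasureTheory Literature.Probability.Percolation Literature.Probability.LatticeModels
open Literature.Probability.Percolation.RegionGluing Literature.Probability.Percolation.BoundaryDecay

/-! ### The square fin: an explicit region strictly above `ℍ` with `θ(p_c) = 0` -/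

section SquareFin

/-- Summability over ordered pairs of distinct squares of `exp(-c (|i² - j²| - 1))` (`c > 0`):
`|i² - j²| ≥ i + j` for `i ≠ j`, so the sum is dominated by `e^{c} (∑ᵢ e^{-ci})²`. -/
theorem tsum_sqPairs_exp_ne_top {c : ℝ} (hc : 0 < c) :
    ∑' q : {q : ℤ × ℤ // q.1 ∈ Set.range (fun j : ℕ => ((j : ℤ)) ^ 2) ∧
        q.2 ∈ Set.range (fun j : ℕ => ((j : ℤ)) ^ 2) ∧ q.1 ≠ q.2},
      ENNReal.ofReal (Real.exp (-c * ((q.1.1 - q.1.2).natAbs - 1 : ℕ))) ≠ ⊤ := by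
  have hr1 : ENNReal.ofReal (Real.exp (-c)) < 1 :=
    ENNReal.ofReal_lt_one.2 (Real.exp_lt_one_iff.2 (by linarith))
  have hsq : ∀ i : ℕ, (Int.sqrt ((i : ℤ) ^ 2)).toNat = i := fun i => by
    rw [sq, Int.sqrt_eq]; simp
  let φ : {q : ℤ × ℤ // q.1 ∈ Set.range (fun j : ℕ => ((j : ℤ)) ^ 2) ∧
        q.2 ∈ Set.range (fun j : ℕ => ((j : ℤ)) ^ 2) ∧ q.1 ≠ q.2} → ℕ × ℕ :=
    fun q => ((Int.sqrt q.1.1).toNat, (Int.sqrt q.1.2).toNat)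
  have hφ1 : ∀ q : {q : ℤ × ℤ // q.1 ∈ Set.range (fun j : ℕ => ((j : ℤ)) ^ 2) ∧
        q.2 ∈ Set.range (fun j : ℕ => ((j : ℤ)) ^ 2) ∧ q.1 ≠ q.2},
      ((φ q).1 : ℤ) ^ 2 = q.1.1 ∧ ((φ q).2 : ℤ) ^ 2 = q.1.2 := by
    rintro ⟨⟨a, b⟩, ⟨i, hi⟩, ⟨j, hj⟩, hne⟩
    simp only at hi hj
    subst hi; subst hj
    simp [φ, hsq]
  have hφ : Function.Injective φ := by
    intro q q' h
    have h1 := hφ1 q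
    have h2 := hφ1 q'
    rw [h] at h1
    exact Subtype.ext (Prod.ext (h1.1.symm.trans h2.1) (h1.2.symm.trans h2.2))
  let g : ℕ × ℕ → ENNReal := fun ij =>
    ENNReal.ofReal (Real.exp c) *
      (ENNReal.ofReal (Real.exp (-c)) ^ ij.1 * ENNReal.ofReal (Real.exp (-c)) ^ ij.2)
  have hle : ∀ q : {q : ℤ × ℤ // q.1 ∈ Set.range (fun j : ℕ => ((j : ℤ)) ^ 2) ∧
        q.2 ∈ Set.range (fun j : ℕ => ((j : ℤ)) ^ 2) ∧ q.1 ≠ q.2},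
      ENNReal.ofReal (Real.exp (-c * ((q.1.1 - q.1.2).natAbs - 1 : ℕ))) ≤ g (φ q) := by
    intro q
    obtain ⟨h1, h2⟩ := hφ1 q
    have hne : q.1.1 ≠ q.1.2 := q.2.2.2
    have hij : (φ q).1 ≠ (φ q).2 := fun h => hne (by rw [← h1, ← h2, h])
    have hi0 : (0 : ℤ) ≤ (φ q).1 := by positivity
    have hj0 : (0 : ℤ) ≤ (φ q).2 := by positivity
    have key : ((φ q).1 : ℤ) + (φ q).2 ≤ ((q.1.1 - q.1.2).natAbs : ℤ) := by
      rw [← h1, ← h2, Int.natCast_natAbs]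
      rcases lt_or_gt_of_ne hij with h | h
      · have h' : ((φ q).1 : ℤ) + 1 ≤ (φ q).2 := by exact_mod_cast h
        rw [abs_sub_comm, abs_of_nonneg (by nlinarith)]
        nlinarith
      · have h' : ((φ q).2 : ℤ) + 1 ≤ (φ q).1 := by exact_mod_cast h
        rw [abs_of_nonneg (by nlinarith)]
        nlinarith
    have hN : (φ q).1 + (φ q).2 - 1 ≤ (q.1.1 - q.1.2).natAbs - 1 := by omega
    have h1le : 1 ≤ (φ q).1 + (φ q).2 := by omega
    have hR : ((φ q).1 : ℝ) + (φ q).2 - 1 ≤ (((q.1.1 - q.1.2).natAbs - 1 : ℕ) : ℝ) := by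
      have h' : (((φ q).1 + (φ q).2 - 1 : ℕ) : ℝ) ≤ (((q.1.1 - q.1.2).natAbs - 1 : ℕ) : ℝ) := by
        exact_mod_cast hN
      have h'' : (((φ q).1 + (φ q).2 - 1 : ℕ) : ℝ) = ((φ q).1 : ℝ) + (φ q).2 - 1 := by
        rw [Nat.cast_sub h1le, Nat.cast_add, Nat.cast_one]
      linarith
    have hexp : Real.exp (-c * ((q.1.1 - q.1.2).natAbs - 1 : ℕ)) ≤
        Real.exp c * (Real.exp (-c) ^ (φ q).1 * Real.exp (-c) ^ (φ q).2) := by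
      rw [← Real.exp_nat_mul, ← Real.exp_nat_mul, ← Real.exp_add, ← Real.exp_add, Real.exp_le_exp]
      nlinarith [mul_le_mul_of_nonneg_left hR hc.le]
    calc ENNReal.ofReal (Real.exp (-c * ((q.1.1 - q.1.2).natAbs - 1 : ℕ)))
        ≤ ENNReal.ofReal (Real.exp c * (Real.exp (-c) ^ (φ q).1 * Real.exp (-c) ^ (φ q).2)) :=
          ENNReal.ofReal_le_ofReal hexp
      _ = g (φ q) := by
          simp only [g]
          rw [ENNReal.ofReal_mul (Real.exp_pos c).le,
            ENNReal.ofReal_mul (pow_nonneg (Real.exp_pos _).le _),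
            ENNReal.ofReal_pow (Real.exp_pos _).le, ENNReal.ofReal_pow (Real.exp_pos _).le]
  have hfin : (1 - ENNReal.ofReal (Real.exp (-c)))⁻¹ ≠ ⊤ :=
    ENNReal.inv_ne_top.2 (tsub_pos_iff_lt.2 hr1).ne'
  have hS : ∑' ij : ℕ × ℕ, g ij ≠ ⊤ := by
    simp only [g]
    rw [ENNReal.tsum_mul_left, ENNReal.tsum_prod']
    simp_rw [ENNReal.tsum_mul_left, ENNReal.tsum_geometric, ENNReal.tsum_mul_right,
      ENNReal.tsum_geometric]
    exact ENNReal.mul_ne_top ENNReal.ofReal_ne_top (ENNReal.mul_ne_top hfin hfin)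
  exact ne_top_of_le_ne_top hS
    ((ENNReal.tsum_le_tsum hle).trans (ENNReal.tsum_comp_le_tsum_of_injective hφ g))

/-- **Explicit sparse fins, general form.** If the height set `Z` has
`Σ_{z ≠ z' ∈ Z} exp(-c (|z - z'| - 1)) < ∞` for EVERY `c > 0` (e.g. gaps `g_j` with `g_j / log j → ∞`),
then the fin attached along `Z` does not percolate at `p_c(ℤ³)` — unconditionally. -/
theorem theta_induce_sparseFin_criticalProbI_eq_zero_of_expSummable (Z : Set ℤ)
    (hZ : ∀ c : ℝ, 0 < c →
      ∑' q : {q : ℤ × ℤ // q.1 ∈ Z ∧ q.2 ∈ Z ∧ q.1 ≠ q.2},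
        ENNReal.ofReal (Real.exp (-c * ((q.1.1 - q.1.2).natAbs - 1 : ℕ))) ≠ ⊤)
    (x : Site 3)
    (hx : x ∈ {x : Site 3 | 0 ≤ x 0} ∪
      {x : Site 3 | (x 1 = 0 ∧ x 0 ≤ -2) ∨ (x 1 = 0 ∧ x 0 = -1 ∧ x 2 ∈ Z)}) :
    theta ((zdGraph 3).induce ({x : Site 3 | 0 ≤ x 0} ∪
      {x : Site 3 | (x 1 = 0 ∧ x 0 ≤ -2) ∨ (x 1 = 0 ∧ x 0 = -1 ∧ x 2 ∈ Z)})) ⟨x, hx⟩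
      (criticalProbI 3) = 0 := by
  obtain ⟨c, hc, hdec⟩ := exists_exp_decay_finFeet
  refine theta_induce_sparseFin_criticalProbI_eq_zero_of_finSide Z ?_ x hx
  refine ne_top_of_le_ne_top (hZ c hc) (ENNReal.tsum_le_tsum fun q => ?_)
  exact hdec q.1.1 q.1.2 q.2.2.2

/-- **The square fin does not percolate at `p_c(ℤ³)`.** The region
`ℍ ∪ {x₁ = 0, x₀ ≤ -2} ∪ {(-1, 0, j²) : j ∈ ℕ}` — the half-space with a full planar half-plane
hanging off it through the connectors at the square heights — satisfies `θ(p_c(ℤ³)) = 0` at every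
root.  An EXPLICIT region strictly between `ℍ` and `ℤ³`, contained in no half-space, with no
percolation at the critical point of `ℤ³` — unconditionally (BGN on both sides, the one-sided
gluing criterion, Borel–Cantelli, and planar sharpness at `p_c(ℤ³) < 1/2` transported to the plane
of the fin). -/
theorem theta_induce_squareFin_criticalProbI_eq_zero (x : Site 3)
    (hx : x ∈ {x : Site 3 | 0 ≤ x 0} ∪
      {x : Site 3 | (x 1 = 0 ∧ x 0 ≤ -2) ∨
        (x 1 = 0 ∧ x 0 = -1 ∧ x 2 ∈ Set.range (fun j : ℕ => ((j : ℤ)) ^ 2))}) :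
    theta ((zdGraph 3).induce ({x : Site 3 | 0 ≤ x 0} ∪
      {x : Site 3 | (x 1 = 0 ∧ x 0 ≤ -2) ∨
        (x 1 = 0 ∧ x 0 = -1 ∧ x 2 ∈ Set.range (fun j : ℕ => ((j : ℤ)) ^ 2))})) ⟨x, hx⟩
      (criticalProbI 3) = 0 := by
  obtain ⟨c, hc, hdec⟩ := exists_exp_decay_finFeet
  refine theta_induce_sparseFin_criticalProbI_eq_zero_of_finSide _ ?_ x hx
  refine ne_top_of_le_ne_top (tsum_sqPairs_exp_ne_top hc) (ENNReal.tsum_le_tsum fun q => ?_)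
  exact hdec q.1.1 q.1.2 q.2.2.2

/-- **The square fin is continuous at its own critical point** (modulo Grimmett–Marstrand's
`p_c(ℍ) = p_c(ℤ³)`, a named fact of the tree): `p_c(square fin) = p_c(ℤ³)` by sandwiching, and
`θ_{square fin}(p_c(square fin)) = 0`. -/
theorem theta_induce_squareFin_own_criticalProb_eq_zero (hGM : GrimmettMarstrand1990_halfSpace) :
    ∃ h0 : (0 : Site 3) ∈ {x : Site 3 | 0 ≤ x 0} ∪
        {x : Site 3 | (x 1 = 0 ∧ x 0 ≤ -2) ∨
          (x 1 = 0 ∧ x 0 = -1 ∧ x 2 ∈ Set.range (fun j : ℕ => ((j : ℤ)) ^ 2))},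
      theta ((zdGraph 3).induce ({x : Site 3 | 0 ≤ x 0} ∪
          {x : Site 3 | (x 1 = 0 ∧ x 0 ≤ -2) ∨
            (x 1 = 0 ∧ x 0 = -1 ∧ x 2 ∈ Set.range (fun j : ℕ => ((j : ℤ)) ^ 2))})) ⟨0, h0⟩
        ⟨criticalProb ((zdGraph 3).induce ({x : Site 3 | 0 ≤ x 0} ∪
            {x : Site 3 | (x 1 = 0 ∧ x 0 ≤ -2) ∨
              (x 1 = 0 ∧ x 0 = -1 ∧ x 2 ∈ Set.range (fun j : ℕ => ((j : ℤ)) ^ 2))})) ⟨0, h0⟩,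
          criticalProb_mem_Icc _ _⟩ = 0 := by
  have h0 : (0 : Site 3) ∈ {x : Site 3 | 0 ≤ x 0} ∪
      {x : Site 3 | (x 1 = 0 ∧ x 0 ≤ -2) ∨
        (x 1 = 0 ∧ x 0 = -1 ∧ x 2 ∈ Set.range (fun j : ℕ => ((j : ℤ)) ^ 2))} :=
    Or.inl (show (0 : ℤ) ≤ (0 : Site 3) 0 from le_rfl)
  refine ⟨h0, ?_⟩
  have hsub : halfSpace 3 ⊆ {x : Site 3 | 0 ≤ x 0} ∪
      {x : Site 3 | (x 1 = 0 ∧ x 0 ≤ -2) ∨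
        (x 1 = 0 ∧ x 0 = -1 ∧ x 2 ∈ Set.range (fun j : ℕ => ((j : ℤ)) ^ 2))} :=
    fun x hx => Or.inl hx
  have hpc : criticalProb ((zdGraph 3).induce ({x : Site 3 | 0 ≤ x 0} ∪
      {x : Site 3 | (x 1 = 0 ∧ x 0 ≤ -2) ∨
        (x 1 = 0 ∧ x 0 = -1 ∧ x 2 ∈ Set.range (fun j : ℕ => ((j : ℤ)) ^ 2))})) ⟨0, h0⟩ =
      criticalProb (zdGraph 3) 0 := by
    refine le_antisymm ?_ (criticalProb_le_induce theta_induce_le_holds (zdGraph 3) _ 0 h0)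
    calc criticalProb ((zdGraph 3).induce ({x : Site 3 | 0 ≤ x 0} ∪
          {x : Site 3 | (x 1 = 0 ∧ x 0 ≤ -2) ∨
            (x 1 = 0 ∧ x 0 = -1 ∧ x 2 ∈ Set.range (fun j : ℕ => ((j : ℤ)) ^ 2))})) ⟨0, h0⟩
        ≤ criticalProb ((zdGraph 3).induce (halfSpace 3)) ⟨0, zero_mem_halfSpace 3⟩ :=
          criticalProb_induce_anti theta_induce_mono_holds (zdGraph 3) hsub 0 (zero_mem_halfSpace 3)
      _ = criticalProb (zdGraph 3) 0 := hGM 3 (by norm_num)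
  have hI : (⟨criticalProb ((zdGraph 3).induce ({x : Site 3 | 0 ≤ x 0} ∪
      {x : Site 3 | (x 1 = 0 ∧ x 0 ≤ -2) ∨
        (x 1 = 0 ∧ x 0 = -1 ∧ x 2 ∈ Set.range (fun j : ℕ => ((j : ℤ)) ^ 2))})) ⟨0, h0⟩,
        criticalProb_mem_Icc _ _⟩ : unitInterval) = criticalProbI 3 := Subtype.ext hpc
  rw [hI]
  exact theta_induce_squareFin_criticalProbI_eq_zero 0 h0

end SquareFin

/-! ### Fins with super-logarithmic gaps

The sharp form of the explicit-fin theorem: if the attachment heights `f 0 < f 1 < ⋯` have gaps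
`g_k = f (k+1) - f k` with `Σ_k exp(-c g_k) < ∞` for EVERY `c > 0` (equivalently
`g_k / log k → ∞`), the fin does not percolate at `p_c(ℤ³)`.  Squares (`g_k = 2k + 1`) are the
showcase; bounded gaps are the open fin rung. -/
section GapFins

/-- Strictly increasing integer sequences grow at least linearly. -/
theorem sub_le_sub_of_strictMono {f : ℕ → ℤ} (hf : StrictMono f) {i k : ℕ} (h : i ≤ k) :
    ((k : ℤ) - i) ≤ f k - f i := by
  induction k with
  | zero =>
    obtain rfl : i = 0 := Nat.le_zero.1 h
    simp
  | succ k ih =>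
    rcases Nat.lt_or_eq_of_le h with hlt | heq
    · have h1 := ih (Nat.lt_succ_iff.1 hlt)
      have hs : f k < f (k + 1) := hf (Nat.lt_succ_self k)
      push_cast
      linarith
    · subst heq
      simp

/-- Summability over ordered pairs of distinct attachment heights, from exp-summable gaps:
for `a < b = k + 1`, `|f a - f b| - 1 ≥ (g_k - 1) + (k - a)`, so the pair sum is dominated by
`2 e^{c} (Σ_k e^{-c g_k}) (Σ_m e^{-c m})`. -/
theorem tsum_rangePairs_exp_ne_top {c : ℝ} (hc : 0 < c) {f : ℕ → ℤ} (hf : StrictMono f)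
    (hgap : ∑' k : ℕ, ENNReal.ofReal (Real.exp (-c * ((f (k + 1) - f k : ℤ) : ℝ))) ≠ ⊤) :
    ∑' q : {q : ℤ × ℤ // q.1 ∈ Set.range f ∧ q.2 ∈ Set.range f ∧ q.1 ≠ q.2},
      ENNReal.ofReal (Real.exp (-c * ((q.1.1 - q.1.2).natAbs - 1 : ℕ))) ≠ ⊤ := by
  set r : ENNReal := ENNReal.ofReal (Real.exp (-c)) with hr
  have hr1 : r < 1 := ENNReal.ofReal_lt_one.2 (Real.exp_lt_one_iff.2 (by linarith))
  set B : ℕ → ENNReal := fun k => ENNReal.ofReal (Real.exp (-c * ((f (k + 1) - f k : ℤ) : ℝ)))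
    with hB
  have hidx : ∀ q : {q : ℤ × ℤ // q.1 ∈ Set.range f ∧ q.2 ∈ Set.range f ∧ q.1 ≠ q.2},
      ∃ ab : ℕ × ℕ, f ab.1 = q.1.1 ∧ f ab.2 = q.1.2 := fun q =>
    ⟨(q.2.1.choose, q.2.2.1.choose), q.2.1.choose_spec, q.2.2.1.choose_spec⟩
  choose φ hφ using hidx
  have hφne : ∀ q, (φ q).1 ≠ (φ q).2 := fun q h =>
    q.2.2.2 (by rw [← (hφ q).1, ← (hφ q).2, h])
  -- the key one-pair estimate, for indices `a < b`
  have key : ∀ a b : ℕ, a < b →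
      ENNReal.ofReal (Real.exp (-c * ((f a - f b).natAbs - 1 : ℕ))) ≤
        ENNReal.ofReal (Real.exp c) * (B (b - 1) * r ^ (b - 1 - a)) := by
    intro a b hab
    obtain ⟨k, rfl⟩ : ∃ k, b = k + 1 := ⟨b - 1, by omega⟩
    have hak : a ≤ k := by omega
    have hlin : ((k : ℤ) - a) ≤ f k - f a := sub_le_sub_of_strictMono hf hak
    have hks : f k < f (k + 1) := hf (Nat.lt_succ_self k)
    have hak' : f a ≤ f k := hf.monotone hak
    have habs : (((f a - f (k + 1)).natAbs : ℕ) : ℤ) = f (k + 1) - f a := by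
      rw [Int.natCast_natAbs, abs_sub_comm, abs_of_nonneg (by linarith)]
    have h1 : 1 ≤ (f a - f (k + 1)).natAbs := by
      have : (1 : ℤ) ≤ (((f a - f (k + 1)).natAbs : ℕ) : ℤ) := by rw [habs]; linarith
      exact_mod_cast this
    have hR : (c * (((f (k + 1) - f k : ℤ)) : ℝ) - c) + c * ((k - a : ℕ) : ℝ) ≤
        c * ((((f a - f (k + 1)).natAbs - 1 : ℕ)) : ℝ) := by
      have e1 : ((((f a - f (k + 1)).natAbs - 1 : ℕ)) : ℝ) =
          (((f a - f (k + 1)).natAbs : ℕ) : ℝ) - 1 := by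
        rw [Nat.cast_sub h1, Nat.cast_one]
      have e2 : (((f a - f (k + 1)).natAbs : ℕ) : ℝ) = (((f (k + 1) - f a : ℤ)) : ℝ) := by
        rw [← habs, Int.cast_natCast]
      have e3 : ((k - a : ℕ) : ℝ) = (k : ℝ) - a := by rw [Nat.cast_sub hak]
      have hlinR : ((k : ℝ) - a) ≤ (((f k - f a : ℤ)) : ℝ) := by exact_mod_cast hlin
      rw [e1, e2, e3]
      push_cast at hlinR ⊢
      nlinarith [hc]
    have hexp : Real.exp (-c * ((f a - f (k + 1)).natAbs - 1 : ℕ)) ≤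
        Real.exp c * (Real.exp (-c * ((f (k + 1) - f k : ℤ) : ℝ)) * Real.exp (-c) ^ (k - a)) := by
      rw [← Real.exp_nat_mul, ← Real.exp_add, ← Real.exp_add, Real.exp_le_exp]
      nlinarith [hR]
    have eb : k + 1 - 1 = k := by omega
    rw [eb]
    calc ENNReal.ofReal (Real.exp (-c * ((f a - f (k + 1)).natAbs - 1 : ℕ)))
        ≤ ENNReal.ofReal (Real.exp c *
            (Real.exp (-c * ((f (k + 1) - f k : ℤ) : ℝ)) * Real.exp (-c) ^ (k - a))) :=
          ENNReal.ofReal_le_ofReal hexp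
      _ = ENNReal.ofReal (Real.exp c) * (B k * r ^ (k - a)) := by
          rw [ENNReal.ofReal_mul (Real.exp_pos c).le, ENNReal.ofReal_mul (Real.exp_pos _).le,
            ENNReal.ofReal_pow (Real.exp_pos _).le]
  -- reindex ordered pairs of indices by (orientation, smaller index, gap count)
  let ψ : {q : ℤ × ℤ // q.1 ∈ Set.range f ∧ q.2 ∈ Set.range f ∧ q.1 ≠ q.2} → Bool × ℕ × ℕ :=
    fun q => if (φ q).1 < (φ q).2 then (true, (φ q).1, (φ q).2 - 1 - (φ q).1)
      else (false, (φ q).2, (φ q).1 - 1 - (φ q).2)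
  have hψ : Function.Injective ψ := by
    intro q q' h
    have hq := hφ q
    have hq' := hφ q'
    have h1 := hφne q
    have h2 := hφne q'
    simp only [ψ] at h
    split_ifs at h with hlt hlt'
    · simp only [Prod.mk.injEq, true_and] at h
      obtain ⟨ha, hm⟩ := h
      have hb : (φ q).2 = (φ q').2 := by omega
      exact Subtype.ext (Prod.ext (by rw [← hq.1, ← hq'.1, ha]) (by rw [← hq.2, ← hq'.2, hb]))
    · simp at h
    · simp at h
    · simp only [Prod.mk.injEq, true_and] at h
      obtain ⟨hb, hm⟩ := h
      have ha : (φ q).1 = (φ q').1 := by omega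
      exact Subtype.ext (Prod.ext (by rw [← hq.1, ← hq'.1, ha]) (by rw [← hq.2, ← hq'.2, hb]))
  let g : Bool × ℕ × ℕ → ENNReal := fun t =>
    ENNReal.ofReal (Real.exp c) * (B (t.2.1 + t.2.2) * r ^ t.2.2)
  have hle : ∀ q : {q : ℤ × ℤ // q.1 ∈ Set.range f ∧ q.2 ∈ Set.range f ∧ q.1 ≠ q.2},
      ENNReal.ofReal (Real.exp (-c * ((q.1.1 - q.1.2).natAbs - 1 : ℕ))) ≤ g (ψ q) := by
    intro q
    have hq := hφ q
    rw [← hq.1, ← hq.2]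
    simp only [ψ, g]
    split_ifs with hlt
    · have e : (φ q).1 + ((φ q).2 - 1 - (φ q).1) = (φ q).2 - 1 := by omega
      simp only [e]
      exact key _ _ hlt
    · have hgt : (φ q).2 < (φ q).1 := lt_of_le_of_ne (not_lt.1 hlt) (hφne q).symm
      have e : (φ q).2 + ((φ q).1 - 1 - (φ q).2) = (φ q).1 - 1 := by omega
      simp only [e]
      rw [← Int.natAbs_neg, neg_sub]
      exact key _ _ hgt
  have hfin : (1 - r)⁻¹ ≠ ⊤ := ENNReal.inv_ne_top.2 (tsub_pos_iff_lt.2 hr1).ne'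
  have hin : ∑' im : ℕ × ℕ, B (im.1 + im.2) * r ^ im.2 ≤ (∑' k, B k) * (1 - r)⁻¹ := by
    rw [ENNReal.tsum_prod', ENNReal.tsum_comm]
    calc ∑' m, ∑' i, B (i + m) * r ^ m = ∑' m, (∑' i, B (i + m)) * r ^ m := by
          simp_rw [ENNReal.tsum_mul_right]
      _ ≤ ∑' m, (∑' k, B k) * r ^ m := ENNReal.tsum_le_tsum fun m =>
          mul_le_mul' (ENNReal.tsum_comp_le_tsum_of_injective (add_left_injective m) B) le_rfl
      _ = (∑' k, B k) * (1 - r)⁻¹ := by rw [ENNReal.tsum_mul_left, ENNReal.tsum_geometric]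
  have hin' : ∑' im : ℕ × ℕ, B (im.1 + im.2) * r ^ im.2 ≠ ⊤ :=
    ne_top_of_le_ne_top (ENNReal.mul_ne_top hgap hfin) hin
  have hS : ∑' t : Bool × ℕ × ℕ, g t ≠ ⊤ := by
    simp only [g]
    rw [ENNReal.tsum_mul_left, ENNReal.tsum_prod', tsum_bool]
    exact ENNReal.mul_ne_top ENNReal.ofReal_ne_top (ENNReal.add_ne_top.2 ⟨hin', hin'⟩)
  exact ne_top_of_le_ne_top hS
    ((ENNReal.tsum_le_tsum hle).trans (ENNReal.tsum_comp_le_tsum_of_injective hψ g))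

/-- **Explicit sparse fins, sharp form: super-logarithmic gaps suffice.** If the attachment heights
`f 0 < f 1 < ⋯` have gaps with `Σ_k exp(-c (f (k+1) - f k)) < ∞` for every `c > 0` (e.g.
`(f (k+1) - f k) / log k → ∞`), then `ℍ ∪ {x₁ = 0, x₀ ≤ -2} ∪ {(-1, 0, f k)}` does not percolate at
`p_c(ℤ³)`, at any root — unconditionally. -/
theorem theta_induce_sparseFin_criticalProbI_eq_zero_of_gaps {f : ℕ → ℤ} (hf : StrictMono f)
    (hgap : ∀ c : ℝ, 0 < c →
      ∑' k : ℕ, ENNReal.ofReal (Real.exp (-c * ((f (k + 1) - f k : ℤ) : ℝ))) ≠ ⊤)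
    (x : Site 3)
    (hx : x ∈ {x : Site 3 | 0 ≤ x 0} ∪
      {x : Site 3 | (x 1 = 0 ∧ x 0 ≤ -2) ∨ (x 1 = 0 ∧ x 0 = -1 ∧ x 2 ∈ Set.range f)}) :
    theta ((zdGraph 3).induce ({x : Site 3 | 0 ≤ x 0} ∪
      {x : Site 3 | (x 1 = 0 ∧ x 0 ≤ -2) ∨ (x 1 = 0 ∧ x 0 = -1 ∧ x 2 ∈ Set.range f)})) ⟨x, hx⟩
      (criticalProbI 3) = 0 :=
  theta_induce_sparseFin_criticalProbI_eq_zero_of_expSummable (Set.range f)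
    (fun c hc => tsum_rangePairs_exp_ne_top hc hf (hgap c hc)) x hx

end GapFins

end Summit.CriticalPhenomena.PercolationContinuityZ3.Theorems
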